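import Summits.CriticalPhenomena.CardyFormulaZ2.Theorems.CardyUSTContinuationKirchhoffExtremalLengthG02Dual1

/-!
# The current of the potential of `Ω_δ` and its discrete conjugate on the inner faces
# ([GP19] §3.1–3.2, (CRd), for the `meshDomain` / `discreteArc` discretisation)

Support file for `KirchhoffExtremalLength` (route CardyUSTContinuation of `CardyFormulaZ2`, item
stmt-CriticalPhenomena-11234), towards the upper half of `G02ModulusConvergence` (`…Defs.lean`).
Transposition of §D4 of the tree's `SquareTilingConjugate.lean` to `Ω_δ = discreteDomainGraph Ω δ`
with the objects `ecur`, `ecurH`, `ecurV`, `facePot`, `faceGraph` of `…Defs.lean`: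

* the current (`ecur_antisymm`, `ecur_of_adj`, `divAt_ecur`, `divAt_ecur_eq_zero`,
  `ecur_eq_zero_of_not_mem_sqBox`);
* **closed walks of inner faces carry no flux** (`walkFlux_eq_zero_of_closed'`: the divergence
  of the current of a potential harmonic off `T ∪ B ⊆ ∂Ω_δ` sits on `∂Ω_δ`, around which such
  walks do not wind, `walkWinding_eq_zero_of_mem_meshBoundary`);
* the conjugate is computed by any walk (`facePot_eq_walkFlux`), the **discrete Cauchy–Riemann
  identity** (`facePot_sub_facePot_of_adj`) and dual harmonicity
  (`sum_stepFlux_eq_zero_of_isInnerFace`).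
-/

noncomputable section

namespace Summit.CriticalPhenomena.CardyFormulaZ2.Theorems

namespace KirchhoffSlope

open Set Metric Filter Topology SimpleGraph
open Literature.Probability Literature.Probability.LatticeModels Literature.Probability.Percolation
open Literature.Probability.LatticeModels.SquareTiling (stepFlux walkFlux walkFlux_append walkFlux_reverse
  walkFlux_cons divAt walkFlux_eq_zero_of_winding)
open Literature.Probability.RandomPlanarGeometry

variable {Ω : Set ℂ} {δ : ℝ}

/-! ### The current -/

/-- The current is antisymmetric. [folklore] -/
theorem ecur_antisymm (h : Site 2 → ℝ) (x y : Site 2) : ecur Ω δ h y x = -ecur Ω δ h x y := by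
  unfold ecur
  by_cases hxy : (discreteDomainGraph Ω δ).Adj x y
  · rw [if_pos hxy, if_pos hxy.symm]; ring
  · rw [if_neg hxy, if_neg fun h' => hxy h'.symm]; ring

/-- The current along an edge of `Ω_δ`. [folklore] -/
theorem ecur_of_adj {h : Site 2 → ℝ} {x y : Site 2} (hxy : (discreteDomainGraph Ω δ).Adj x y) :
    ecur Ω δ h x y = h x - h y := if_pos hxy

/-- No current off the edges of `Ω_δ`. [folklore] -/
theorem ecur_of_not_adj {h : Site 2 → ℝ} {x y : Site 2} (hxy : ¬ (discreteDomainGraph Ω δ).Adj x y) :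
    ecur Ω δ h x y = 0 := if_neg hxy

open Classical in
/-- The divergence of the current at the lattice point `x` is minus the harmonicity defect of
`h` at `x` for the graph `Ω_δ`. [folklore] -/
theorem divAt_ecur (h : Site 2 → ℝ) (x : Site 2) :
    divAt (ecurH Ω δ h) (ecurV Ω δ h) (x - 1) =
      -∑ y ∈ ((zdGraph 2).neighborFinset x).filter (fun y => (discreteDomainGraph Ω δ).Adj x y), (h y - h x) := by
  rw [Finset.sum_filter, sum_neighborFinset_zdGraph, Fin.sum_univ_two]
  have e1 : x - 1 + 1 = x := by abel
  have e2 : x - 1 - Pi.single 0 1 + 1 = x - Pi.single 0 1 := by abel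
  have e3 : x - 1 - Pi.single 1 1 + 1 = x - Pi.single 1 1 := by abel
  have e4 : x - Pi.single 0 1 + Pi.single 0 1 = x := by abel
  have e5 : x - Pi.single 1 1 + Pi.single 1 1 = x := by abel
  simp only [divAt, ecurH, ecurV, e1, e2, e3, e4, e5]
  rw [ecur_antisymm h x (x - Pi.single 0 1), ecur_antisymm h x (x - Pi.single 1 1)]
  simp only [ecur]
  split_ifs <;> ring

open Classical in
/-- If `h` is harmonic for `Ω_δ` at every vertex off `T ∪ B`, the divergence of its current
vanishes off `T ∪ B`. [folklore] -/
theorem divAt_ecur_eq_zero {h : Site 2 → ℝ} {T B : Set (Site 2)}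
    (hharm : ∀ x, x ∉ T → x ∉ B →
      ∑ y ∈ ((zdGraph 2).neighborFinset x).filter (fun y => (discreteDomainGraph Ω δ).Adj x y), (h y - h x) = 0)
    {u : Site 2} (hT : u + 1 ∉ T) (hB : u + 1 ∉ B) : divAt (ecurH Ω δ h) (ecurV Ω δ h) u = 0 := by
  have := divAt_ecur (Ω := Ω) (δ := δ) h (u + 1)
  rw [show u + 1 - 1 = u by abel] at this
  rw [this, hharm _ hT hB, neg_zero]

open WeakBeurling in
/-- The currents vanish off a box: if `Ω ⊆ B̄(0, r₀)`, `ecurH`, `ecurV` and their translates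
vanish at `u ∉ sqBox 0 (⌈r₀/δ⌉ + 1)`. [folklore] -/
theorem ecur_eq_zero_of_not_mem_sqBox {r₀ : ℝ} (hΩ : Ω ⊆ closedBall 0 r₀) (hδ : 0 < δ)
    (h : Site 2 → ℝ) {u : Site 2} (hu : u ∉ sqBox 0 (⌈r₀ / δ⌉ + 1)) :
    (ecurH Ω δ h u = 0 ∧ ecurV Ω δ h u = 0) ∧
      (ecurH Ω δ h (u - Pi.single 0 1) = 0 ∧ ecurV Ω δ h (u - Pi.single 1 1) = 0) := by
  -- every vertex of an edge of `Ω_δ` is in the box `⌈r₀/δ⌉`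
  have key : ∀ x y : Site 2, (discreteDomainGraph Ω δ).Adj x y → x ∈ sqBox 0 ⌈r₀ / δ⌉ := fun x y hxy =>
    mem_sqBox_of_mem_meshDomain hΩ hδ (discreteDomainGraph_adj_iff.1 hxy).2.1
  have out : ∀ v : Site 2, (|v 0 - u 0| ≤ 1 ∧ |v 1 - u 1| ≤ 1) → ∀ y, ¬ (discreteDomainGraph Ω δ).Adj v y := by
    intro v hv y hvy
    have hb := key v y hvy
    rw [mem_sqBox] at hb hu
    simp only [Pi.zero_apply, sub_zero] at hb hu
    rw [abs_le, abs_le] at hb hv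
    rw [not_and_or, not_le, not_le, lt_abs, lt_abs] at hu
    omega
  refine ⟨⟨ecur_of_not_adj (out _ ⟨?_, ?_⟩ _), ecur_of_not_adj (out _ ⟨?_, ?_⟩ _)⟩,
    ⟨ecur_of_not_adj (out _ ⟨?_, ?_⟩ _), ecur_of_not_adj (out _ ⟨?_, ?_⟩ _)⟩⟩ <;> simp

/-! ### Closed walks of inner faces carry no flux; the conjugate -/

open WeakBeurling Classical in
/-- **Closed walks of inner faces carry no flux.** For a conformal rectangle and a potential `h`
harmonic for `Ω_δ` off subsets `T, B ⊆ ∂Ω_δ = meshBoundary` (e.g. the potential of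
`exists_g02Potential`, `T`, `B` the discrete arcs), the flux of the current of `h` through every
closed walk of the face graph (based at an inner face) is zero: divergence sits on `∂Ω_δ`, around
which such walks do not wind. [cite: GeorgakopoulosPanagiotis2019, §3.1] -/
theorem walkFlux_eq_zero_of_closed' (R : ConformalRectangle)
    (hδ : 0 < δ) {h : Site 2 → ℝ} {T B : Set (Site 2)} (hT : T ⊆ meshBoundary R.carrier δ)
    (hB : B ⊆ meshBoundary R.carrier δ)
    (hharm : ∀ x, x ∉ T → x ∉ B →
      ∑ y ∈ ((zdGraph 2).neighborFinset x).filter (fun y => (discreteDomainGraph R.carrier δ).Adj x y),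
        (h y - h x) = 0)
    {a : Site 2} (ha : IsInnerFace R.carrier δ a) (Λ : (faceGraph R.carrier δ).Walk a a) :
    walkFlux (ecurH R.carrier δ h) (ecurV R.carrier δ h) (Λ.map (Hom.ofLE (faceGraph_le_zdGraph R.carrier δ))) = 0 := by
  classical
  obtain ⟨r₀, hr₀⟩ := (isBounded_iff_subset_closedBall (0 : ℂ)).1 R.isBounded
  set S : Finset (Site 2) := (sqBox_finite 0 (⌈r₀ / δ⌉ + 1)).toFinset with hS
  have hmemS : ∀ u, u ∉ S → u ∉ sqBox 0 (⌈r₀ / δ⌉ + 1) := fun u hu h => hu (by simpa [hS] using h)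
  refine walkFlux_eq_zero_of_winding (S := S)
    (fun u hu => (ecur_eq_zero_of_not_mem_sqBox hr₀ hδ h (hmemS u hu)).1)
    (fun u hu => (ecur_eq_zero_of_not_mem_sqBox hr₀ hδ h (hmemS u hu)).2) _ fun u _ hdiv => ?_
  -- non-zero divergence at `u + 1` forces `u + 1 ∈ T ∪ B ⊆ ∂Ω_δ`
  have hTB : u + 1 ∈ T ∨ u + 1 ∈ B := by
    by_contra hc
    rw [not_or] at hc
    exact hdiv (divAt_ecur_eq_zero hharm hc.1 hc.2)
  have hbd : u + 1 ∈ meshBoundary R.carrier δ := hTB.elim (fun h => hT h) (fun h => hB h)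
  have := walkWinding_eq_zero_of_mem_meshBoundary R hδ ha Λ hbd
  rwa [show u + 1 - 1 = u by abel] at this

open Classical in
/-- The conjugate is computed by any walk of the face graph from the base face. [folklore] -/
theorem facePot_eq_walkFlux (R : ConformalRectangle)
    (hδ : 0 < δ) {h : Site 2 → ℝ} {T B : Set (Site 2)} (hT : T ⊆ meshBoundary R.carrier δ)
    (hB : B ⊆ meshBoundary R.carrier δ)
    (hharm : ∀ x, x ∉ T → x ∉ B →
      ∑ y ∈ ((zdGraph 2).neighborFinset x).filter (fun y => (discreteDomainGraph R.carrier δ).Adj x y),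
        (h y - h x) = 0)
    {p₀ p : Site 2} (hp₀ : IsInnerFace R.carrier δ p₀) (W : (faceGraph R.carrier δ).Walk p₀ p) :
    facePot R.carrier δ h p₀ p =
      walkFlux (ecurH R.carrier δ h) (ecurV R.carrier δ h) (W.map (Hom.ofLE (faceGraph_le_zdGraph R.carrier δ))) := by
  have hp : (faceGraph R.carrier δ).Reachable p₀ p := ⟨W⟩
  rw [facePot, dif_pos hp]
  have key := walkFlux_eq_zero_of_closed' R hδ hT hB hharm hp₀ (hp.some.append W.reverse)
  rw [Walk.map_append, walkFlux_append, ← Walk.reverse_map, walkFlux_reverse] at key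
  linarith

open Classical in
/-- **Discrete Cauchy–Riemann identity** ([GP19], (CRd)): across the common side of two adjacent
faces of the face component of the base face, the conjugate jumps by the current of `h` through
that side (from the left of the step to its right). [cite: GeorgakopoulosPanagiotis2019, §4.1 (CRd)] -/
theorem facePot_sub_facePot_of_adj (R : ConformalRectangle)
    (hδ : 0 < δ) {h : Site 2 → ℝ} {T B : Set (Site 2)} (hT : T ⊆ meshBoundary R.carrier δ)
    (hB : B ⊆ meshBoundary R.carrier δ)
    (hharm : ∀ x, x ∉ T → x ∉ B →
      ∑ y ∈ ((zdGraph 2).neighborFinset x).filter (fun y => (discreteDomainGraph R.carrier δ).Adj x y),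
        (h y - h x) = 0)
    {p₀ p p' : Site 2} (hp₀ : IsInnerFace R.carrier δ p₀) (hp : (faceGraph R.carrier δ).Reachable p₀ p)
    (hpp' : (faceGraph R.carrier δ).Adj p p') :
    facePot R.carrier δ h p₀ p' - facePot R.carrier δ h p₀ p =
      stepFlux (ecurH R.carrier δ h) (ecurV R.carrier δ h) p p' := by
  obtain ⟨W⟩ := hp
  rw [facePot_eq_walkFlux R hδ hT hB hharm hp₀ W,
    facePot_eq_walkFlux R hδ hT hB hharm hp₀ (W.append (Walk.cons hpp' Walk.nil)),
    Walk.map_append, walkFlux_append]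
  simp [walkFlux_cons]

/-- The four CR-increments around an inner face sum to zero (the circulation of `dh` around the
square): the conjugate is harmonic on the dual lattice at every face of the component once each
side not leading into the component is given the virtual value `facePot p + stepFlux`. [folklore] -/
theorem sum_stepFlux_eq_zero_of_isInnerFace {h : Site 2 → ℝ} {p : Site 2} (hp : IsInnerFace Ω δ p) :
    stepFlux (ecurH Ω δ h) (ecurV Ω δ h) p (p + Pi.single 0 1) +
      stepFlux (ecurH Ω δ h) (ecurV Ω δ h) p (p - Pi.single 0 1) +
      stepFlux (ecurH Ω δ h) (ecurV Ω δ h) p (p + Pi.single 1 1) +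
      stepFlux (ecurH Ω δ h) (ecurV Ω δ h) p (p - Pi.single 1 1) = 0 := by
  obtain ⟨hB, hT, hL, hR⟩ := hp
  have s1 : stepFlux (ecurH Ω δ h) (ecurV Ω δ h) p (p + Pi.single 0 1) = -ecurV Ω δ h (p - Pi.single 1 1) := by
    unfold stepFlux
    have c0 : (p + Pi.single 0 1 : Site 2) 0 = p 0 + 1 := by simp
    have c1 : (p + Pi.single 0 1 : Site 2) 1 = p 1 := by simp
    simp [c0, c1]
  have s2 : stepFlux (ecurH Ω δ h) (ecurV Ω δ h) p (p - Pi.single 0 1) = ecurV Ω δ h (p - Pi.single 0 1 - Pi.single 1 1) := by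
    unfold stepFlux
    have c0 : (p - Pi.single 0 1 : Site 2) 0 = p 0 - 1 := by simp
    have c1 : (p - Pi.single 0 1 : Site 2) 1 = p 1 := by simp
    simp [c0, c1]
    omega
  have s3 : stepFlux (ecurH Ω δ h) (ecurV Ω δ h) p (p + Pi.single 1 1) = ecurH Ω δ h (p - Pi.single 0 1) := by
    unfold stepFlux
    have c0 : (p + Pi.single 1 1 : Site 2) 0 = p 0 := by simp
    have c1 : (p + Pi.single 1 1 : Site 2) 1 = p 1 + 1 := by simp
    simp [c0, c1]
  have s4 : stepFlux (ecurH Ω δ h) (ecurV Ω δ h) p (p - Pi.single 1 1) = -ecurH Ω δ h (p - Pi.single 1 1 - Pi.single 0 1) := by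
    unfold stepFlux
    have c0 : (p - Pi.single 1 1 : Site 2) 0 = p 0 := by simp
    have c1 : (p - Pi.single 1 1 : Site 2) 1 = p 1 - 1 := by simp
    simp [c0, c1]
    omega
  rw [s1, s2, s3, s4]
  have e1 : p - Pi.single 1 1 + 1 = p + Pi.single 0 1 := by
    ext i; fin_cases i <;> simp
  have e2 : p - Pi.single 0 1 - Pi.single 1 1 + 1 = p := by
    ext i; fin_cases i <;> simp
  have e3 : p - Pi.single 0 1 + 1 = p + Pi.single 1 1 := by
    ext i; fin_cases i <;> simp
  have e4 : p - Pi.single 1 1 - Pi.single 0 1 + 1 = p := by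
    ext i; fin_cases i <;> simp
  simp only [ecurH, ecurV, e1, e2, e3, e4]
  rw [ecur_of_adj hR, ecur_of_adj hL, ecur_of_adj hB,
    show p + Pi.single 1 1 + Pi.single 0 1 = p + Pi.single 0 1 + Pi.single 1 1 by abel,
    ecur_of_adj (show (discreteDomainGraph Ω δ).Adj (p + Pi.single 1 1) (p + Pi.single 0 1 + Pi.single 1 1) by
      simpa [add_comm, add_left_comm, add_assoc] using hT)]
  ring

end KirchhoffSlope

end Summit.CriticalPhenomena.CardyFormulaZ2.Theorems
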